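import Summits.CriticalPhenomena.PercolationContinuityZ3.Theorems.PercNearOneGluingNoHeavyLowerTailSunflowerMultiPetalLiftCertificate
import HarnessLib
import HarnessLib.Audit

/-!
# `NoHeavyLowerTail` (crux stmt-CriticalPhenomena-4575), abstract sunflower cubic, `k` petals: the LIFT-CERTIFICATE CONJECTURE ('fractional partition lemma',
# typed) and its reduction to `PartitionLemmaK`

Support file (seat `prim-l12-p2` gen 34/35; `--supports stmt-CriticalPhenomena-4575`; companion of `…SunflowerMultiPetalLiftCertificate` (p376479/p376658/p376883)).
No `sorry`; the `@[conjecture]` definition is an obligation of the programme, never a fact.  Memo: run/shared/lean/prim/prim-l12/prim-l12-p2/FINDING-g34-DUAL-NORMAL-FORM.md §11.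

* `MSunflower.HasLiftCertificate F e` — there are a family of up-sets `Ls` of the `M_k` order, potentials `π` on the sub-cubes of `univ.erase e` and nonnegative coloured flows `μ`
  satisfying dual feasibility of the lift LP at every admissible `(X, v)`, with `0 ≤ Σ_X π X` (by LP duality: the FRACTIONAL lift LP of `F ∖ e` has nonnegative value).
* `LiftCertificateK` (OPEN; 0 failures in 6 914 (structure, coordinate) pairs incl. the n = 6 frontier, memo §3/§11): every structure has a lift certificate at every coordinate.
* `partitionLemmaK_of_liftCertificateK` : `LiftCertificateK → PartitionLemmaK` (via `ZK_nonneg_of_liftCertificate`; empty ground types are trivial).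
-/

namespace Summit.CriticalPhenomena.PercolationContinuityZ3.Theorems.SunflowerPartition

open Finset

namespace MSunflower

variable {α : Type*} [DecidableEq α] [Fintype α] {k : ℕ} (F : MSunflower k α)

/-- `F` has a LIFT CERTIFICATE at the coordinate `e`: up-set colours `Ls`, potentials `π`, flows `μ ≥ 0` with dual feasibility on the sub-cubes of `univ.erase e` and
`0 ≤ Σ π` (memo §11). [this work] -/
def HasLiftCertificate (e : α) : Prop :=
  ∃ (Ls : Finset (Finset (Fin (k + 2)))) (π : Finset α → ℤ) (μ : Finset α → α → Finset (Fin (k + 2)) → ℤ),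
    (∀ L ∈ Ls, ∀ a b : Fin (k + 2), a ∈ L → (a = b ∨ a = 0 ∨ b = Fin.last (k + 1)) → b ∈ L) ∧
    (∀ X a L, 0 ≤ μ X a L) ∧
    (∀ X ∈ (univ.erase e).powerset, ∀ v : Fin (k + 2), (F.lab X = v ∨ F.lab X = 0 ∨ v = Fin.last (k + 1)) →
        π X ≤ (∑ S ∈ (univ.erase e \ X).powerset, s6K k v (F.lab S) (F.lab ((univ.erase e \ X) \ S)))
              + (∑ a ∈ univ.erase e \ X, ∑ L ∈ Ls.filter (fun L => v ∈ L), μ X a L)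
              - (∑ a ∈ X, ∑ L ∈ Ls.filter (fun L => v ∈ L), μ (X.erase a) a L)) ∧
    0 ≤ ∑ X ∈ (univ.erase e).powerset, π X

/-- A lift certificate at any coordinate gives ★ₖ for the structure. [this work] -/
theorem ZK_nonneg_of_hasLiftCertificate {e : α} (h : F.HasLiftCertificate e) : 0 ≤ F.ZK := by
  obtain ⟨Ls, π, μ, hLs, hμ, hπ, hsum⟩ := h
  exact F.ZK_nonneg_of_liftCertificate e Ls hLs π μ hμ hπ hsum

end MSunflower

/-- **LIFT-CERTIFICATE CONJECTURE** ('fractional partition lemma', this work; OPEN; memo §11: certificates in the dual normal form exist in every one of 6 914 tested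
(structure, coordinate) pairs): every monotone map into `M_k` on a finite ground type has a lift certificate at every coordinate.  Implies `PartitionLemmaK`
(`partitionLemmaK_of_liftCertificateK`).  An obligation, never a fact: use as `(h : LiftCertificateK)`. [status: open] -/
@[conjecture] def LiftCertificateK : Prop :=
  ∀ (k : ℕ) (α : Type) [Fintype α] [DecidableEq α] (F : MSunflower k α) (e : α), F.HasLiftCertificate e

/-- **Reduction**: the lift-certificate conjecture implies the multi-petal partition lemma ★ₖ. [this work] -/
theorem partitionLemmaK_of_liftCertificateK (h : LiftCertificateK) : PartitionLemmaK := by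
  intro k α _ _ F
  by_cases hα : Nonempty α
  · obtain ⟨e⟩ := hα
    exact F.ZK_nonneg_of_hasLiftCertificate (h k α F e)
  · -- empty ground type: the only ordered 3-partition is (∅, ∅, ∅) and `s6K` vanishes on the diagonal
    rw [← F.ZKW_univ]
    have hu : (univ : Finset α) = ∅ := by
      ext x; exact absurd ⟨x⟩ hα
    rw [hu, F.ZKW_empty]

end Summit.CriticalPhenomena.PercolationContinuityZ3.Theorems.SunflowerPartition
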